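import Summits.HodgeConjecture.HodgeConjecture.Theorems.Ring2AbelianAllAndreIsogenousPencils
import HarnessLib

/-!
# Ring 2 · sub-cell AbelianAll (ALL ABELIAN VARIETIES), André axis, part XXXIV-d — ISOGENOUS PENCILS, THE RANK FORM: along a
# surjective `S`-morphism `ψ : 𝒳 ⟶ 𝒳'` of compact pencils of abelian varieties of the same relative dimension the fibre maps
# `ψ_t^*` and `ψ_{t!}` are INJECTIVE and carry invariant algebraic classes to invariant algebraic classes and lifted classes
# to lifted classes, in both directions; so the two pencils have, at every point and in every degree, THE SAME number of
# algebraic classes on the fibre, of invariant classes, of invariant algebraic classes and of lifted classes — in particular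
# the same LIFT DEFECT `δ_p = dim N^p_inv(fibre) − r_p` of parts XXX-d / XXXI-c / XXXII-d. FACT-FREE

HONEST FRAMING (page 1, verbatim): **research route, not a corollary; conditional on HC_CM plus one named
minimal statement.** Cell line: research route conditional on HC_CM; not a corollary; Q11.4-sentence-2 already
refuted in dim ≥ 3. Nothing in this file proves a case of the Hodge conjecture for an abelian variety; `HC_CM`, `HC_AV`
do not occur; no node is born (0 `def`), no named fact is used, no `sorry`; axioms standard; nothing is claimed minimal.

## What this part does (the quantitative form of parts XXXIII-e / XXXIV-a)

Notation: `N^p_inv(𝒳_t) := N^p(𝒳_t) ∩ Im j_t^*` (invariant algebraic classes of the fibre), `r_p(f)(t) := dim j_t^* N^p(𝒳)`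
(lifted classes); part XXX-d: `(L)_t(p) ⟺ dim N^p_inv(𝒳_t) ≤ r_p(f)(t)`, the difference being the lift defect `δ_p(f, t)`.

* §1 `exists_ne_zero_map_fiberι_push_gysin_eq_smul` — the scalar `c₁` of part XXXIII-e's base change
  `j'_t^* ψ_! = c₁ • ψ_{t!} j_t^*` is a UNIT (read the identity on `1`: `j'_t^* ψ_! 1 = c₃ • 1 ≠ 0`, part XXXII-d's
  `one_fiber_ne_zero` and the degree trick on the total spaces).
* §2 `map_fiberOverMap_injective` (`ψ_t^*` is injective — the degree trick on the fibre), `complexGysin_fiberOverMap_injective`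
  (`ψ_{t!}` is injective in every degree with equal Betti numbers: `ψ_t^* ψ_{t!} = c₂ • id`, part XXXIV-a).
* §3 the four correspondences: `ψ_t^*` maps `N^p_inv(𝒳'_t)` into `N^p_inv(𝒳_t)` and `j'_t^* N^p(𝒳')` into `j_t^* N^p(𝒳)`
  (the latter granted `ψ^*` preserves algebraic classes on the total spaces); `ψ_{t!}` maps `N^p_inv(𝒳_t)` into
  `N^p_inv(𝒳'_t)` and `j_t^* N^p(𝒳)` into `j'_t^* N^p(𝒳')` (§1: divide by `c₁`); likewise for `N^p` of the fibres alone and for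
  the invariants `Im j_t^*` alone.
* §4 hence the EQUALITIES of dimensions (`finrank_algebraicClasses_fiber_eq_of_dominant`, `finrank_range_fiberι_eq_of_dominant`,
  `finrank_inf_range_eq_of_dominant`, `finrank_map_algebraicClasses_eq_of_dominant`) for smooth projective families under the hypotheses `hb` / `hpull` / `hpullTot` of part
  XXXIV-a, and §5 for compact pencils of abelian varieties (`…_of_isogenous`; `ψ` locally quasi-finite for the lifted classes):
  **`finrank_inf_range_eq_of_isogenous`**, **`finrank_map_algebraicClasses_eq_of_isogenous`**, so `δ_p(ψ ≫ f', t) = δ_p(f', t)`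
  (`liftDefect_eq_of_isogenous`, written additively) — consistent with the lift iff of part XXXIV-a through part XXX-d's rank
  criterion `comap_le_sup_iff_finrank_le` (not restated).

READING. Part XXXII-d showed that the Gysin PADDING embeds obstruction spaces (`δ_p(f) ≤ δ_{p+r}(B × 𝒳)`); an ISOGENY over `S`
identifies them (`δ_p(ψ ≫ f') = δ_p(f')`). What is NOT claimed: that `ψ_t^* ψ_{t!}` or the base-change scalars are the degree
of the isogeny (only non-vanishing is proved); anything minimal; any case of HC. EDGE LABELS: every row K (kernel, fact-free).

References: VoisinHodgeI2002 (§7.3.2 Lemma 7.28, Rem. 7.29); Fulton1998 (Prop. 1.7, Thm. 6.2 (a), Ex. 1.7.4, §19.1–19.2);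
LangeBirkenhake1992 (Prop. 1.2.6, Ex. 1.1.6 (8)); MumfordAV1970 (§1, §19); Kleiman1968AlgebraicCycles (§1.2);
Milne2020HodgeClassesAV (Prop. 1); Abdulali1994FamiliesAV ((1.1)); Andre1996Motifs (§6.3, proof of Lemme 6.3.1, p. 32). [Locators revised after REFEREE-AB F-ab-138 / F-ab-142: §5.1 p. 25 of Andre1996Motifs concerns replacing the BASE `S` by a finite étale cover, not the abelian scheme by an isogenous one; the «schéma abélien isogène» sentence is Deligne's.]
-/

noncomputable section

set_option linter.dupNamespace false

namespace Summit.HodgeConjecture.HodgeConjecture.Ring2.AbelianAll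

open CategoryTheory CategoryTheory.Limits AlgebraicGeometry MonoidalCategory CartesianMonoidalCategory
open Literature.AlgebraicGeometry Literature.AlgebraicGeometry.Motives
open Literature.AlgebraicGeometry.HodgeTheory
open Literature.AlgebraicTopology.SingularHomology (singularCohomology)

variable {𝒳 𝒳' S : SchemeOver ℂ}

/-- Linear algebra: an injective linear map carrying `P` into `Q` gives `dim P ≤ dim Q`. [folklore] -/
theorem finrank_le_finrank_of_map_le_of_injective {V W : Type*} [AddCommGroup V] [Module ℂ V] [AddCommGroup W] [Module ℂ W]
    [Module.Finite ℂ W] {g : V →ₗ[ℂ] W} (hg : Function.Injective g) {P : Submodule ℂ V} {Q : Submodule ℂ W}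
    (h : P.map g ≤ Q) : Module.finrank ℂ P ≤ Module.finrank ℂ Q := by
  rw [(Submodule.equivMapOfInjective g hg P).finrank_eq]
  exact Submodule.finrank_mono h

/-! ## §1 The base-change scalar of part XXXIII-e is a unit -/

section Scalar

variable {N d : ℕ} {f' : 𝒳' ⟶ S} {ψ : 𝒳 ⟶ 𝒳'} (μ : OrientationFamily) (hX : IsSmoothProjective N 𝒳)
  (hX' : IsSmoothProjective N 𝒳') (hf : IsSmoothProjectiveFamily (ψ ≫ f') d) (hf' : IsSmoothProjectiveFamily f' d)

variable [IsSeparated S.hom] [Surjective ψ.left]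

include hf hf' in
/-- **`j'_t^* ψ_! = c₁ • ψ_{t!} j_t^*` with `c₁ ≠ 0`** for a surjective `S`-morphism of smooth projective families of the same
relative dimension (part XXXIII-e's clean base change, with the scalar now a unit): on `u = 1`, `j'_t^* ψ_! 1 = j'_t^*(c₃ • 1) =
c₃ • 1 ≠ 0` (`ψ_! 1 = ψ_! ψ^* 1 = c₃ • 1`, `c₃ ≠ 0`, the degree trick; `1 ≠ 0` in `H⁰` of the fibre), so `c₁ = 0` is absurd.
[cite: Fulton1998, Thm. 6.2 (a) and Example 1.7.4] [cite: VoisinHodgeI2002, §7.3.2 Remark 7.29] -/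
theorem exists_ne_zero_map_fiberι_push_gysin_eq_smul (t : ComplexPoints S) :
    ∃ c : ℂ, c ≠ 0 ∧ ∀ ⦃k k₁ : ℕ⦄ (hk : k + 2 * N = k₁ + 2 * N) (u : complexBetti 𝒳 k),
      complexBetti.map (fiberι f' t) k₁ (complexGysin μ hX hX' ψ hk u) =
        c • complexGysin μ (hf.isSmoothProjective t) (hf'.isSmoothProjective t) (fiberOverMap ψ f' t)
          (show k + 2 * d = k₁ + 2 * d by omega) (complexBetti.map (fiberι (ψ ≫ f') t) k u) := by
  obtain ⟨c₁, hc₁⟩ := exists_map_fiberι_push_gysin_eq_smul μ hX hX' hf hf' t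
  refine ⟨c₁, ?_, hc₁⟩
  obtain ⟨c₃, hc₃0, hc₃⟩ := exists_complexGysin_map_eq_smul_of_surjective μ hX hX' ψ
  have h1 := hc₁ (k := 0) (k₁ := 0) rfl (singularCohomology.one ℂ (ComplexPoints 𝒳))
  have hψ1 : complexBetti.map ψ 0 (singularCohomology.one ℂ (ComplexPoints 𝒳')) = singularCohomology.one ℂ (ComplexPoints 𝒳) :=
    singularCohomology.map_one _
  rw [← hψ1, hc₃ 0 rfl, map_smul, map_fiberι_one] at h1
  intro hc
  rw [hc, zero_smul, smul_eq_zero] at h1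
  exact h1.elim hc₃0 (one_fiber_ne_zero μ hf' t)

end Scalar

/-! ## §2 The fibre maps `ψ_t^*` and `ψ_{t!}` are injective -/

section Fibre

variable {d : ℕ} {f' : 𝒳' ⟶ S} {ψ : 𝒳 ⟶ 𝒳'} (μ : OrientationFamily)
  (hf : IsSmoothProjectiveFamily (ψ ≫ f') d) (hf' : IsSmoothProjectiveFamily f' d) [Surjective ψ.left]

include hf hf' in
/-- **`ψ_t^*` is injective in every degree** (the fibre map is surjective between smooth projective varieties of the same
dimension: Voisin's Lemma 7.28). [cite: VoisinHodgeI2002, §7.3.2 Lemma 7.28 and Remark 7.29] -/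
theorem map_fiberOverMap_injective (t : ComplexPoints S) (k : ℕ) :
    Function.Injective (complexBetti.map (fiberOverMap ψ f' t) k) := by
  haveI := surjective_fiberOverMap_left f' ψ t
  exact complexBetti_map_injective_of_surjective_of_dim_eq (hf.isSmoothProjective t) (hf'.isSmoothProjective t) _ k

include hf hf' in
/-- **`ψ_{t!}` is injective in every degree in which the fibres have the same Betti number** (`ψ_t^* ψ_{t!} = c₂ • id`,
`c₂ ≠ 0`, part XXXIV-a). [cite: VoisinHodgeI2002, §7.3.2 Remark 7.29] [cite: LangeBirkenhake1992, Prop. 1.2.6] -/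
theorem complexGysin_fiberOverMap_injective (t : ComplexPoints S)
    (hb : ∀ k, Module.finrank ℂ (complexBetti (fiberOver (ψ ≫ f') t) k) = Module.finrank ℂ (complexBetti (fiberOver f' t) k))
    {k k₁ : ℕ} (hk : k + 2 * d = k₁ + 2 * d) :
    Function.Injective (complexGysin μ (hf.isSmoothProjective t) (hf'.isSmoothProjective t) (fiberOverMap ψ f' t) hk) := by
  obtain rfl : k = k₁ := by omega
  haveI := surjective_fiberOverMap_left f' ψ t
  obtain ⟨c₂, hc₂0, hc₂⟩ := exists_map_complexGysin_eq_smul_of_surjective μ (hf.isSmoothProjective t)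
    (hf'.isSmoothProjective t) (fiberOverMap ψ f' t)
  intro x y hxy
  have h := congrArg (complexBetti.map (fiberOverMap ψ f' t) k) hxy
  rw [hc₂ k (hb k) hk x, hc₂ k (hb k) hk y] at h
  exact smul_right_injective _ hc₂0 h

end Fibre

/-! ## §3 The four correspondences: invariant algebraic classes and lifted classes, in both directions -/

section Correspondences

variable {N d : ℕ} {f' : 𝒳' ⟶ S} {ψ : 𝒳 ⟶ 𝒳'} (μ : OrientationFamily) (hX : IsSmoothProjective N 𝒳)
  (hX' : IsSmoothProjective N 𝒳') (hf : IsSmoothProjectiveFamily (ψ ≫ f') d) (hf' : IsSmoothProjectiveFamily f' d)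

/-- `ψ_t^*` carries algebraic classes of `𝒳'_t` to algebraic classes of `𝒳_t` (hypothesis `hpull`, part XXXIII-e), stated on
subspaces. [cite: Fulton1998, §19.2 Cor. 19.2 (b)] -/
theorem map_fiberOverMap_algebraicClasses_le (t : ComplexPoints S) (p : ℕ)
    (hpull : ∀ y ∈ algebraicClasses (fiberOver f' t) p,
      complexBetti.map (fiberOverMap ψ f' t) (2 * p) y ∈ algebraicClasses (fiberOver (ψ ≫ f') t) p) :
    (algebraicClasses (fiberOver f' t) p).map (complexBetti.map (fiberOverMap ψ f' t) (2 * p)).hom ≤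
      algebraicClasses (fiberOver (ψ ≫ f') t) p := by
  rintro _ ⟨y, hy, rfl⟩
  exact hpull y hy

/-- `ψ_t^*` carries the invariants `Im j'_t^*` into the invariants `Im j_t^*` (`ψ_t^* j'_t^* = j_t^* ψ^*`). [folklore] -/
theorem map_fiberOverMap_range_le (t : ComplexPoints S) (k : ℕ) :
    (LinearMap.range (complexBetti.map (fiberι f' t) k).hom).map (complexBetti.map (fiberOverMap ψ f' t) k).hom ≤
      LinearMap.range (complexBetti.map (fiberι (ψ ≫ f') t) k).hom := by
  rintro _ ⟨_, ⟨W', rfl⟩, rfl⟩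
  refine ⟨complexBetti.map ψ k W', ?_⟩
  change complexBetti.map (fiberι (ψ ≫ f') t) k (complexBetti.map ψ k W') = _
  rw [map_fiberι_map_eq]

/-- **`ψ_t^*` carries `N^p_inv(𝒳'_t)` into `N^p_inv(𝒳_t)`** (granted `hpull`). [cite: Abdulali1994FamiliesAV, (1.1) (p. 1122)]
[cite: Fulton1998, §19.2 Cor. 19.2 (b)] -/
theorem map_fiberOverMap_inf_range_le (t : ComplexPoints S) (p : ℕ)
    (hpull : ∀ y ∈ algebraicClasses (fiberOver f' t) p,
      complexBetti.map (fiberOverMap ψ f' t) (2 * p) y ∈ algebraicClasses (fiberOver (ψ ≫ f') t) p) :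
    (algebraicClasses (fiberOver f' t) p ⊓ LinearMap.range (complexBetti.map (fiberι f' t) (2 * p)).hom).map
        (complexBetti.map (fiberOverMap ψ f' t) (2 * p)).hom ≤
      algebraicClasses (fiberOver (ψ ≫ f') t) p ⊓ LinearMap.range (complexBetti.map (fiberι (ψ ≫ f') t) (2 * p)).hom :=
  (Submodule.map_inf_le _).trans (inf_le_inf (map_fiberOverMap_algebraicClasses_le t p hpull) (map_fiberOverMap_range_le t _))

/-- **`ψ_t^*` carries the lifted classes `j'_t^* N^p(𝒳')` into the lifted classes `j_t^* N^p(𝒳)`**, granted that `ψ^*`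
preserves algebraic classes on the total spaces (`hpullTot`). [cite: Milne2020HodgeClassesAV, Prop. 1 (p. 7)]
[cite: GrothendieckTopology1969, §1] -/
theorem map_fiberOverMap_map_le (t : ComplexPoints S) (p : ℕ)
    (hpullTot : ∀ η' ∈ algebraicClasses 𝒳' p, complexBetti.map ψ (2 * p) η' ∈ algebraicClasses 𝒳 p) :
    ((algebraicClasses 𝒳' p).map (complexBetti.map (fiberι f' t) (2 * p)).hom).map
        (complexBetti.map (fiberOverMap ψ f' t) (2 * p)).hom ≤
      (algebraicClasses 𝒳 p).map (complexBetti.map (fiberι (ψ ≫ f') t) (2 * p)).hom := by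
  rintro _ ⟨_, ⟨η', hη', rfl⟩, rfl⟩
  refine ⟨complexBetti.map ψ (2 * p) η', hpullTot _ hη', ?_⟩
  change complexBetti.map (fiberι (ψ ≫ f') t) (2 * p) (complexBetti.map ψ (2 * p) η') = _
  rw [map_fiberι_map_eq]

variable [IsSeparated S.hom] [Surjective ψ.left]

include hX hX' hf hf' in
/-- **`ψ_{t!}` carries the invariants `Im j_t^*` into the invariants `Im j'_t^*`** (`ψ_{t!} j_t^* W = c₁⁻¹ • j'_t^* ψ_! W`, §1).
[cite: Fulton1998, Thm. 6.2 (a)] -/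
theorem map_complexGysin_range_le (t : ComplexPoints S) {k : ℕ} (hk : k + 2 * d = k + 2 * d) :
    (LinearMap.range (complexBetti.map (fiberι (ψ ≫ f') t) k).hom).map
        (complexGysin μ (hf.isSmoothProjective t) (hf'.isSmoothProjective t) (fiberOverMap ψ f' t) hk) ≤
      LinearMap.range (complexBetti.map (fiberι f' t) k).hom := by
  obtain ⟨c₁, hc₁0, hc₁⟩ := exists_ne_zero_map_fiberι_push_gysin_eq_smul μ hX hX' hf hf' t
  rintro _ ⟨_, ⟨W, rfl⟩, rfl⟩
  refine ⟨c₁⁻¹ • complexGysin μ hX hX' ψ (rfl : k + 2 * N = k + 2 * N) W, ?_⟩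
  change complexBetti.map (fiberι f' t) k (c₁⁻¹ • complexGysin μ hX hX' ψ rfl W) = _
  rw [map_smul, hc₁ rfl W, smul_smul, inv_mul_cancel₀ hc₁0, one_smul]

include hX hX' hf hf' in
/-- **`ψ_{t!}` carries `N^p_inv(𝒳_t)` into `N^p_inv(𝒳'_t)`** (Gysin maps preserve algebraic classes; §1 for the invariance).
[cite: Fulton1998, Thm. 6.2 (a) and §19.1] [cite: Abdulali1994FamiliesAV, (1.1) (p. 1122)] -/
theorem map_complexGysin_inf_range_le (t : ComplexPoints S) (p : ℕ) :
    (algebraicClasses (fiberOver (ψ ≫ f') t) p ⊓ LinearMap.range (complexBetti.map (fiberι (ψ ≫ f') t) (2 * p)).hom).map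
        (complexGysin μ (hf.isSmoothProjective t) (hf'.isSmoothProjective t) (fiberOverMap ψ f' t)
          (rfl : 2 * p + 2 * d = 2 * p + 2 * d)) ≤
      algebraicClasses (fiberOver f' t) p ⊓ LinearMap.range (complexBetti.map (fiberι f' t) (2 * p)).hom := by
  refine (Submodule.map_inf_le _).trans (inf_le_inf ?_ (map_complexGysin_range_le μ hX hX' hf hf' t _))
  rintro _ ⟨x, hx, rfl⟩
  exact complexGysin_mem_algebraicClasses_of_mem_algebraicClasses μ (hf.isSmoothProjective t) (hf'.isSmoothProjective t) _ _ hx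

include hX hX' hf hf' in
/-- **`ψ_{t!}` carries the lifted classes `j_t^* N^p(𝒳)` into the lifted classes `j'_t^* N^p(𝒳')`** (`ψ_{t!} j_t^* η =
c₁⁻¹ • j'_t^*(ψ_! η)` with `ψ_! η` algebraic). [cite: Fulton1998, Thm. 6.2 (a) and §19.1] [cite: Milne2020HodgeClassesAV, Prop. 1 (p. 7)] -/
theorem map_complexGysin_map_le (t : ComplexPoints S) (p : ℕ) :
    ((algebraicClasses 𝒳 p).map (complexBetti.map (fiberι (ψ ≫ f') t) (2 * p)).hom).map
        (complexGysin μ (hf.isSmoothProjective t) (hf'.isSmoothProjective t) (fiberOverMap ψ f' t)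
          (rfl : 2 * p + 2 * d = 2 * p + 2 * d)) ≤
      (algebraicClasses 𝒳' p).map (complexBetti.map (fiberι f' t) (2 * p)).hom := by
  obtain ⟨c₁, hc₁0, hc₁⟩ := exists_ne_zero_map_fiberι_push_gysin_eq_smul μ hX hX' hf hf' t
  rintro _ ⟨_, ⟨η, hη, rfl⟩, rfl⟩
  refine ⟨c₁⁻¹ • complexGysin μ hX hX' ψ (rfl : 2 * p + 2 * N = 2 * p + 2 * N) η,
    Submodule.smul_mem _ _ (complexGysin_mem_algebraicClasses_of_mem_algebraicClasses μ hX hX' ψ _ hη), ?_⟩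
  change complexBetti.map (fiberι f' t) (2 * p) (c₁⁻¹ • complexGysin μ hX hX' ψ rfl η) = _
  rw [map_smul, hc₁ rfl η, smul_smul, inv_mul_cancel₀ hc₁0, one_smul]

end Correspondences

/-! ## §4 Equal dimensions, for smooth projective families -/

section Finrank

variable {N d : ℕ} {f' : 𝒳' ⟶ S} {ψ : 𝒳 ⟶ 𝒳'} (hX : IsSmoothProjective N 𝒳)
  (hX' : IsSmoothProjective N 𝒳') (hf : IsSmoothProjectiveFamily (ψ ≫ f') d) (hf' : IsSmoothProjectiveFamily f' d)

variable [IsSeparated S.hom] [Surjective ψ.left]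

omit [IsSeparated S.hom] in
include hf hf' in
/-- **The fibres `𝒳_t`, `𝒳'_t` carry the same number of algebraic classes in every degree** (granted `hb`, `hpull`):
`ψ_t^* : N^p(𝒳'_t) ↪ N^p(𝒳_t)` and `ψ_{t!} : N^p(𝒳_t) ↪ N^p(𝒳'_t)`. [cite: Kleiman1968AlgebraicCycles, §1.2] [cite: Fulton1998, §19.1–19.2] -/
theorem finrank_algebraicClasses_fiber_eq_of_dominant (t : ComplexPoints S)
    (hb : ∀ k, Module.finrank ℂ (complexBetti (fiberOver (ψ ≫ f') t) k) = Module.finrank ℂ (complexBetti (fiberOver f' t) k))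
    (p : ℕ) (hpull : ∀ y ∈ algebraicClasses (fiberOver f' t) p,
      complexBetti.map (fiberOverMap ψ f' t) (2 * p) y ∈ algebraicClasses (fiberOver (ψ ≫ f') t) p) :
    Module.finrank ℂ ↥(algebraicClasses (fiberOver (ψ ≫ f') t) p) = Module.finrank ℂ ↥(algebraicClasses (fiberOver f' t) p) := by
  let μ : OrientationFamily := fun _ _ h ↦ (Motives.ComplexPoints.isOrientableOver ℂ h).some
  haveI : Module.Finite ℂ (complexBetti (fiberOver (ψ ≫ f') t) (2 * p)) := finite_complexBetti (hf.isSmoothProjective t) _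
  haveI : Module.Finite ℂ (complexBetti (fiberOver f' t) (2 * p)) := finite_complexBetti (hf'.isSmoothProjective t) _
  refine le_antisymm ?_ ?_
  · refine finrank_le_finrank_of_map_le_of_injective (complexGysin_fiberOverMap_injective μ hf hf' t hb rfl) ?_
    rintro _ ⟨x, hx, rfl⟩
    exact complexGysin_mem_algebraicClasses_of_mem_algebraicClasses μ (hf.isSmoothProjective t) (hf'.isSmoothProjective t) _ _ hx
  · exact finrank_le_finrank_of_map_le_of_injective (map_fiberOverMap_injective hf hf' t (2 * p))
      (map_fiberOverMap_algebraicClasses_le t p hpull)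

include hX hX' hf hf' in
/-- **The fibres `𝒳_t`, `𝒳'_t` carry the same number of invariant classes in every degree** (granted `hb`): `ψ_t^*` and
`ψ_{t!}` exchange `Im j_t^*` and `Im j'_t^*` injectively. [cite: Fulton1998, Thm. 6.2 (a)] [cite: VoisinHodgeI2002, §7.3.2 Remark 7.29] -/
theorem finrank_range_fiberι_eq_of_dominant (t : ComplexPoints S)
    (hb : ∀ k, Module.finrank ℂ (complexBetti (fiberOver (ψ ≫ f') t) k) = Module.finrank ℂ (complexBetti (fiberOver f' t) k))
    (k : ℕ) :
    Module.finrank ℂ ↥(LinearMap.range (complexBetti.map (fiberι (ψ ≫ f') t) k).hom) =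
      Module.finrank ℂ ↥(LinearMap.range (complexBetti.map (fiberι f' t) k).hom) := by
  let μ : OrientationFamily := fun _ _ h ↦ (Motives.ComplexPoints.isOrientableOver ℂ h).some
  haveI : Module.Finite ℂ (complexBetti (fiberOver (ψ ≫ f') t) k) := finite_complexBetti (hf.isSmoothProjective t) _
  haveI : Module.Finite ℂ (complexBetti (fiberOver f' t) k) := finite_complexBetti (hf'.isSmoothProjective t) _
  exact le_antisymm
    (finrank_le_finrank_of_map_le_of_injective (complexGysin_fiberOverMap_injective μ hf hf' t hb rfl)
      (map_complexGysin_range_le μ hX hX' hf hf' t _))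
    (finrank_le_finrank_of_map_le_of_injective (map_fiberOverMap_injective hf hf' t k) (map_fiberOverMap_range_le t k))

include hX hX' hf hf' in
/-- **`dim N^p_inv(𝒳_t) = dim N^p_inv(𝒳'_t)`**: the fibres carry the same number of INVARIANT ALGEBRAIC classes (granted
`hb`, `hpull`). [cite: Abdulali1994FamiliesAV, (1.1) (p. 1122)] [cite: Fulton1998, Thm. 6.2 (a) and §19.1–19.2] -/
theorem finrank_inf_range_eq_of_dominant (t : ComplexPoints S)
    (hb : ∀ k, Module.finrank ℂ (complexBetti (fiberOver (ψ ≫ f') t) k) = Module.finrank ℂ (complexBetti (fiberOver f' t) k))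
    (p : ℕ) (hpull : ∀ y ∈ algebraicClasses (fiberOver f' t) p,
      complexBetti.map (fiberOverMap ψ f' t) (2 * p) y ∈ algebraicClasses (fiberOver (ψ ≫ f') t) p) :
    Module.finrank ℂ ↥(algebraicClasses (fiberOver (ψ ≫ f') t) p ⊓ LinearMap.range (complexBetti.map (fiberι (ψ ≫ f') t) (2 * p)).hom) =
      Module.finrank ℂ ↥(algebraicClasses (fiberOver f' t) p ⊓ LinearMap.range (complexBetti.map (fiberι f' t) (2 * p)).hom) := by
  let μ : OrientationFamily := fun _ _ h ↦ (Motives.ComplexPoints.isOrientableOver ℂ h).some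
  haveI : Module.Finite ℂ (complexBetti (fiberOver (ψ ≫ f') t) (2 * p)) := finite_complexBetti (hf.isSmoothProjective t) _
  haveI : Module.Finite ℂ (complexBetti (fiberOver f' t) (2 * p)) := finite_complexBetti (hf'.isSmoothProjective t) _
  exact le_antisymm
    (finrank_le_finrank_of_map_le_of_injective (complexGysin_fiberOverMap_injective μ hf hf' t hb rfl)
      (map_complexGysin_inf_range_le μ hX hX' hf hf' t p))
    (finrank_le_finrank_of_map_le_of_injective (map_fiberOverMap_injective hf hf' t (2 * p))
      (map_fiberOverMap_inf_range_le t p hpull))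

include hX hX' hf hf' in
/-- **`r_p(ψ ≫ f')(t) = r_p(f')(t)`**: the fibres carry the same number of LIFTED algebraic classes (granted `hb` and that
`ψ^*` preserves algebraic classes on the total spaces, `hpullTot`). [cite: Milne2020HodgeClassesAV, Prop. 1 (p. 7)]
[cite: Fulton1998, Thm. 6.2 (a) and §19.1] -/
theorem finrank_map_algebraicClasses_eq_of_dominant (t : ComplexPoints S)
    (hb : ∀ k, Module.finrank ℂ (complexBetti (fiberOver (ψ ≫ f') t) k) = Module.finrank ℂ (complexBetti (fiberOver f' t) k))
    (p : ℕ) (hpullTot : ∀ η' ∈ algebraicClasses 𝒳' p, complexBetti.map ψ (2 * p) η' ∈ algebraicClasses 𝒳 p) :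
    Module.finrank ℂ ↥((algebraicClasses 𝒳 p).map (complexBetti.map (fiberι (ψ ≫ f') t) (2 * p)).hom) =
      Module.finrank ℂ ↥((algebraicClasses 𝒳' p).map (complexBetti.map (fiberι f' t) (2 * p)).hom) := by
  let μ : OrientationFamily := fun _ _ h ↦ (Motives.ComplexPoints.isOrientableOver ℂ h).some
  haveI : Module.Finite ℂ (complexBetti (fiberOver (ψ ≫ f') t) (2 * p)) := finite_complexBetti (hf.isSmoothProjective t) _
  haveI : Module.Finite ℂ (complexBetti (fiberOver f' t) (2 * p)) := finite_complexBetti (hf'.isSmoothProjective t) _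
  exact le_antisymm
    (finrank_le_finrank_of_map_le_of_injective (complexGysin_fiberOverMap_injective μ hf hf' t hb rfl)
      (map_complexGysin_map_le μ hX hX' hf hf' t p))
    (finrank_le_finrank_of_map_le_of_injective (map_fiberOverMap_injective hf hf' t (2 * p))
      (map_fiberOverMap_map_le t p hpullTot))

end Finrank

/-! ## §5 Compact pencils of abelian varieties: isogenous pencils have the same ranks and the same lift defect -/

section Pencils

variable {d : ℕ} {f' : 𝒳' ⟶ S} {ψ : 𝒳 ⟶ 𝒳'} (hf : IsCompactAbelianPencil (ψ ≫ f') d) (hf' : IsCompactAbelianPencil f' d)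

variable [Surjective ψ.left]

include hf hf' in
/-- **Isogenous pencils: the fibres have the same number of algebraic classes**, `dim N^p((ψ ≫ f')_t) = dim N^p(f'_t)`, for a
surjective `S`-morphism of compact abelian pencils of the same relative dimension. FACT-FREE. [cite: Kleiman1968AlgebraicCycles, §1.2]
[cite: MumfordAV1970, §19 Thm. 1] -/
theorem finrank_algebraicClasses_fiber_eq_of_isogenous (t : ComplexPoints S) (p : ℕ) :
    Module.finrank ℂ ↥(algebraicClasses (fiberOver (ψ ≫ f') t) p) = Module.finrank ℂ ↥(algebraicClasses (fiberOver f' t) p) := by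
  exact finrank_algebraicClasses_fiber_eq_of_dominant hf.isSmoothProjectiveFamily hf'.isSmoothProjectiveFamily t
    (finrank_complexBetti_fiber_eq_of_pencils hf hf' t) p (pull_of_pencil hf hf' t p)

include hf hf' in
/-- **Isogenous pencils: the fibres have the same number of invariant classes**, `dim Im j_t^* = dim Im j'_t^*`, every degree.
FACT-FREE. [cite: Fulton1998, Thm. 6.2 (a)] [cite: VoisinHodgeI2002, §7.3.2 Remark 7.29] -/
theorem finrank_range_fiberι_eq_of_isogenous (t : ComplexPoints S) (k : ℕ) :
    Module.finrank ℂ ↥(LinearMap.range (complexBetti.map (fiberι (ψ ≫ f') t) k).hom) =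
      Module.finrank ℂ ↥(LinearMap.range (complexBetti.map (fiberι f' t) k).hom) := by
  haveI : IsProper S.hom := IsSmoothProjective.isProper_holds hf.isSmoothProjective_base
  exact finrank_range_fiberι_eq_of_dominant hf.isSmoothProjective_total hf'.isSmoothProjective_total hf.isSmoothProjectiveFamily
    hf'.isSmoothProjectiveFamily t (finrank_complexBetti_fiber_eq_of_pencils hf hf' t) k

include hf hf' in
/-- **ISOGENOUS PENCILS HAVE THE SAME NUMBER OF INVARIANT ALGEBRAIC CLASSES**: `dim N^p_inv((ψ ≫ f')_t) = dim N^p_inv(f'_t)`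
at every point, every degree. FACT-FREE. [cite: Abdulali1994FamiliesAV, (1.1) (p. 1122)] [cite: Andre1996Motifs, §6.3 proof of Lemme 6.3.1 (p. 32)] -/
theorem finrank_inf_range_eq_of_isogenous (t : ComplexPoints S) (p : ℕ) :
    Module.finrank ℂ ↥(algebraicClasses (fiberOver (ψ ≫ f') t) p ⊓ LinearMap.range (complexBetti.map (fiberι (ψ ≫ f') t) (2 * p)).hom) =
      Module.finrank ℂ ↥(algebraicClasses (fiberOver f' t) p ⊓ LinearMap.range (complexBetti.map (fiberι f' t) (2 * p)).hom) := by
  haveI : IsProper S.hom := IsSmoothProjective.isProper_holds hf.isSmoothProjective_base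
  exact finrank_inf_range_eq_of_dominant hf.isSmoothProjective_total hf'.isSmoothProjective_total hf.isSmoothProjectiveFamily
    hf'.isSmoothProjectiveFamily t (finrank_complexBetti_fiber_eq_of_pencils hf hf' t) p (pull_of_pencil hf hf' t p)

include hf hf' in
/-- **ISOGENOUS PENCILS HAVE THE SAME NUMBER OF LIFTED CLASSES**: `r_p(ψ ≫ f')(t) = r_p(f')(t)` at every point, every degree,
for `ψ` locally quasi-finite (an isogeny is finite). FACT-FREE. [cite: Milne2020HodgeClassesAV, Prop. 1 (p. 7)] [cite: Andre1996Motifs, §6.3 proof of Lemme 6.3.1 (p. 32)] -/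
theorem finrank_map_algebraicClasses_eq_of_isogenous [LocallyQuasiFinite ψ.left] (t : ComplexPoints S) (p : ℕ) :
    Module.finrank ℂ ↥((algebraicClasses 𝒳 p).map (complexBetti.map (fiberι (ψ ≫ f') t) (2 * p)).hom) =
      Module.finrank ℂ ↥((algebraicClasses 𝒳' p).map (complexBetti.map (fiberι f' t) (2 * p)).hom) := by
  haveI : IsProper S.hom := IsSmoothProjective.isProper_holds hf.isSmoothProjective_base
  exact finrank_map_algebraicClasses_eq_of_dominant hf.isSmoothProjective_total hf'.isSmoothProjective_total hf.isSmoothProjectiveFamily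
    hf'.isSmoothProjectiveFamily t (finrank_complexBetti_fiber_eq_of_pencils hf hf' t) p
    (fun _ hη' ↦ map_mem_algebraicClasses_of_locallyQuasiFinite hf.isSmoothProjective_total hf'.isSmoothProjective_total ψ hη')

include hf hf' in
/-- **ISOGENOUS PENCILS HAVE THE SAME LIFT DEFECT**, `δ_p(ψ ≫ f', t) = δ_p(f', t)` where `δ_p(f, t) = dim N^p_inv(𝒳_t) − r_p(f)(t)`
(parts XXX-d / XXXI-c / XXXII-d), written additively: `dim N^p_inv((ψ ≫ f')_t) + r_p(f')(t) = dim N^p_inv(f'_t) + r_p(ψ ≫ f')(t)`.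
FACT-FREE. [cite: Andre1996Motifs, §6.3 proof of Lemme 6.3.1 (p. 32)] [cite: Milne2020HodgeClassesAV, Prop. 1 (p. 7)] -/
theorem liftDefect_eq_of_isogenous [LocallyQuasiFinite ψ.left] (t : ComplexPoints S) (p : ℕ) :
    Module.finrank ℂ ↥(algebraicClasses (fiberOver (ψ ≫ f') t) p ⊓ LinearMap.range (complexBetti.map (fiberι (ψ ≫ f') t) (2 * p)).hom) +
        Module.finrank ℂ ↥((algebraicClasses 𝒳' p).map (complexBetti.map (fiberι f' t) (2 * p)).hom) =
      Module.finrank ℂ ↥(algebraicClasses (fiberOver f' t) p ⊓ LinearMap.range (complexBetti.map (fiberι f' t) (2 * p)).hom) +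
        Module.finrank ℂ ↥((algebraicClasses 𝒳 p).map (complexBetti.map (fiberι (ψ ≫ f') t) (2 * p)).hom) := by
  rw [finrank_inf_range_eq_of_isogenous hf hf' t p, finrank_map_algebraicClasses_eq_of_isogenous hf hf' t p]

end Pencils

end Summit.HodgeConjecture.HodgeConjecture.Ring2.AbelianAll

end
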